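import Summits.AnomalousDissipation.AnomalousDissipation.Theorems.BaireTransferDenseLoudDesignerForcesErgodicLine
import Literature.Analysis.FluidPDE.NSEnstrophyBalance2DGalerkin
import Literature.Analysis.FluidPDE.AlexakisDoeringInterpolation
import Literature.Analysis.FunctionSpaces.LatticeSobolevRellich
import Literature.Analysis.FunctionSpaces.TorusTrigPoly
import HarnessLib

/-!
# Stub `stub_compactSublevel` of the line `SketchIdeator2` (card `separatrix-flux-pinning`)
# (crux `MarginalStabilityChain.ChainRealisation`, stmt-AnomalousDissipation-14249)

Sorry-free discharge of the registered stub `stub_compactSublevel` (P4) of the lead's skeleton: the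
functional-analytic facts behind the compact phase `K` of the line.  For every level `C : ℝ` the SPECTRAL
`H²`-SUBLEVEL SET `S_C = {v ∈ H : ‖Δv‖₂² ≤ C}` of the energy space `H = Torus.energySpace (Fin 3)`
(`‖Δv‖₂² = eLaplacianNormSq (rep v) = 16π⁴ ∑ₖ |k|⁴ ‖v̂(k)‖²`) is

* COMPACT in `H` (Rellich: `H² ↪ L²` is compact on `T³`);
* the enstrophy `enstrophyObs v = ‖∇v‖₂² = 4π² ∑ₖ |k|² ‖v̂(k)‖²` is FINITE on `S_C` (`‖∇v‖₂² ≤ ‖Δv‖₂²`, as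
  `|k|² ≤ |k|⁴` on `ℤ³ ∖ {0}` and `4π² ≤ 16π⁴`);
* and `L²`-CONTINUOUS on `S_C`.

**Proof.**  Everything is read off the Fourier coefficients `v̂(k) = 𝓕(complexify ∘ rep v)(k)` of the `L²`
class, which are `1`-Lipschitz in `v` (`Torus.continuous_mFourierCoeff_complexify_coe`) and satisfy Parseval
`‖v‖² = ∑ₖ ‖v̂(k)‖²` (`Torus.enorm_sq_coe_eq_tsum`).
* Closedness of `S_C`: Fatou for the series `16π⁴ ∑ |k|⁴ ‖·‖²` under coefficientwise convergence
  (`Torus.eLaplacianNormSq_le_liminf_of_tendsto_coeff`).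
* Sequential compactness: the coefficient families of a sequence in `S_C` are bounded in the lattice
  Sobolev norm `H_2` (`(1+|k|²)² ≤ 16π⁴|k|⁴` off `k = 0`, and the zero mode of a field in `H` vanishes,
  `Torus.mFourierCoeff_complexify_coe_zero_of_mem`), so Warner's lattice Rellich lemma (`Lattice.rellich`,
  `H_2 ↪ H_0` compact) extracts a subsequence that is Cauchy in `H_0 = L²`; `H` is complete and `S_C` closed.
  In a metric space sequential compactness is compactness.
* Continuity of the enstrophy on `S_C`: the low-mode truncations `∑_{|k| ≤ N} 4π²|k|²‖v̂(k)‖²` are continuous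
  and converge to `‖∇v‖₂²` UNIFORMLY on `S_C`, the tail being `≤ ‖Δv‖₂²/N² ≤ C/N²`
  (`N² · 4π²|k|² ≤ 16π⁴|k|⁴` for `|k| > N`); a uniform limit of continuous functions is continuous.

References: R. Temam, *Navier–Stokes Equations and Nonlinear Functional Analysis*, 2nd ed. (SIAM 1995),
Ch. I §2.1 (the spaces `H^m_per`, compactness of `H^{m+1}_per ↪ H^m_per`); F. W. Warner, *Foundations of
Differentiable Manifolds and Lie Groups*, GTM 94 (1983), Lemma 6.23 (Rellich on the lattice); P. Constantin,
C. Foias, *Navier–Stokes Equations* (1988), Ch. 4 (the space `H`).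
-/

set_option linter.dupNamespace false

noncomputable section

open MeasureTheory Set Filter Topology UnitAddTorus
open scoped InnerProductSpace ENNReal
open Literature.Analysis.FunctionSpaces Literature.Analysis.FunctionSpaces.Torus
open Literature.Analysis.FluidPDE Literature.Analysis.FluidPDE.Torus

namespace Summit.AnomalousDissipation.AnomalousDissipation.Theorems.ChainRealisation.SeparatrixFluxPinning

open Summit.AnomalousDissipation.AnomalousDissipation.Theorems.DenseLoudDesignerForces.Ergodic

namespace CompactSublevel

/-! ## Fourier coefficients of a state -/

/-- Each Fourier coefficient `v ↦ v̂(k) = 𝓕(complexify ∘ rep v)(k)` is continuous on `H` (a bounded linear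
functional of the `L²` class, `Torus.continuous_mFourierCoeff_complexify_coe`). -/
theorem continuous_coef (k : Fin 3 → ℤ) :
    Continuous fun v : Hsp => mFourierCoeff (EuclideanSpace.complexify ∘ rep v) k :=
  (continuous_mFourierCoeff_complexify_coe k).comp continuous_subtype_val

/-- Fourier coefficients of a difference of states. -/
theorem coef_sub (v w : Hsp) (k : Fin 3 → ℤ) :
    mFourierCoeff (EuclideanSpace.complexify ∘ rep (v - w)) k =
      mFourierCoeff (EuclideanSpace.complexify ∘ rep v) k - mFourierCoeff (EuclideanSpace.complexify ∘ rep w) k := by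
  unfold rep
  rw [Submodule.coe_sub]
  exact mFourierCoeff_complexify_coe_sub _ _ k

/-- The zero mode of a state vanishes (`H` is mean-zero). -/
theorem coef_zero (v : Hsp) : mFourierCoeff (EuclideanSpace.complexify ∘ rep v) 0 = 0 :=
  mFourierCoeff_complexify_coe_zero_of_mem v.2

/-- Parseval on `H`: `‖v‖² = ∑ₖ ‖v̂(k)‖²` in `[0, ∞]`. -/
theorem enorm_sq_eq_tsum_coef (v : Hsp) :
    ‖v‖ₑ ^ 2 = ∑' k, ‖mFourierCoeff (EuclideanSpace.complexify ∘ rep v) k‖ₑ ^ 2 :=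
  enorm_sq_coe_eq_tsum (v : Lp (EuclideanSpace ℝ (Fin 3)) 2 (volume : Measure (UnitAddTorus (Fin 3))))

/-! ## The spectral enstrophy and palinstrophy of a state as weighted series -/

/-- `‖∇v‖₂² = ∑ₖ 4π²|k|² ‖v̂(k)‖²`. -/
theorem eGradNormSq_rep_eq (v : Hsp) :
    eGradNormSq (rep v) = ∑' k, ENNReal.ofReal (4 * Real.pi ^ 2 * freqNormSq k) *
      ‖mFourierCoeff (EuclideanSpace.complexify ∘ rep v) k‖ₑ ^ 2 := by
  rw [eGradNormSq_eq_tsum, ← ENNReal.tsum_mul_left]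
  refine tsum_congr fun k => ?_
  rw [← mul_assoc, ENNReal.ofReal_mul (show (0 : ℝ) ≤ 4 * Real.pi ^ 2 by positivity)]

/-- `‖Δv‖₂² = ∑ₖ 16π⁴|k|⁴ ‖v̂(k)‖²`. -/
theorem eLaplacianNormSq_rep_eq (v : Hsp) :
    eLaplacianNormSq (rep v) = ∑' k, ENNReal.ofReal (16 * Real.pi ^ 4 * freqNormSq k ^ 2) *
      ‖mFourierCoeff (EuclideanSpace.complexify ∘ rep v) k‖ₑ ^ 2 := by
  rw [eLaplacianNormSq, eHomSobolevSeminorm_two_sq_eq_tsum, ← ENNReal.tsum_mul_left]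
  refine tsum_congr fun k => ?_
  rw [← mul_assoc]
  congr 1
  by_cases hk : k = 0
  · subst hk
    simp
  · rw [if_neg hk, ← ENNReal.ofReal_pow (freqNormSq_nonneg k), ← ENNReal.ofReal_mul (by positivity)]

/-- `4π²|k|² ≤ 16π⁴|k|⁴` on the integer lattice (`|k|² ≥ 1` off the origin). -/
theorem weight_grad_le_weight_lap (k : Fin 3 → ℤ) :
    ENNReal.ofReal (4 * Real.pi ^ 2 * freqNormSq k) ≤ ENNReal.ofReal (16 * Real.pi ^ 4 * freqNormSq k ^ 2) := by
  refine ENNReal.ofReal_le_ofReal ?_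
  by_cases hk : k = 0
  · subst hk
    simp
  · have h1 : 1 ≤ freqNormSq k := one_le_freqNormSq hk
    have hπ : 1 ≤ Real.pi := by linarith [Real.pi_gt_three]
    have hπ2 : 1 ≤ Real.pi ^ 2 := one_le_pow₀ hπ
    have h2 : 1 ≤ 4 * Real.pi ^ 2 * freqNormSq k := by nlinarith
    have h3 : 0 ≤ 4 * Real.pi ^ 2 * freqNormSq k := by positivity
    nlinarith [mul_le_mul_of_nonneg_left h2 h3]

/-- **Finite enstrophy on spectral `H²`-sublevel sets**: `‖∇v‖₂² ≤ ‖Δv‖₂²` for every `v ∈ H`. -/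
theorem eGradNormSq_le_eLaplacianNormSq (v : Hsp) : eGradNormSq (rep v) ≤ eLaplacianNormSq (rep v) := by
  rw [eGradNormSq_rep_eq, eLaplacianNormSq_rep_eq]
  exact ENNReal.tsum_le_tsum fun k => mul_le_mul' (weight_grad_le_weight_lap k) le_rfl

/-! ## Closedness of the sublevel sets (Fatou) -/

/-- The spectral `H²`-sublevel sets `{‖Δv‖₂² ≤ C}` are closed in `H` (coefficients are continuous, Fatou for
the series). -/
theorem isClosed_sublevel (C : ℝ) : IsClosed {v : Hsp | eLaplacianNormSq (rep v) ≤ ENNReal.ofReal C} := by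
  refine IsSeqClosed.isClosed fun x v hx hv => ?_
  have hc : ∀ k, Tendsto (fun n => mFourierCoeff (EuclideanSpace.complexify ∘ rep (x n)) k) atTop
      (𝓝 (mFourierCoeff (EuclideanSpace.complexify ∘ rep v) k)) := fun k =>
    ((continuous_coef k).tendsto v).comp hv
  exact (eLaplacianNormSq_le_liminf_of_tendsto_coeff hc).trans
    (liminf_le_of_frequently_le' (Frequently.of_forall hx))

/-! ## Compactness (Rellich on the lattice) -/

/-- The coefficient family of a state is bounded in the lattice norm `H_2` by the palinstrophy:
`∑ (1+|k|²)² ‖v̂(k)‖² ≤ ‖Δv‖₂²` (zero mode vanishes; `(1+|k|²)² ≤ 4|k|⁴ ≤ 16π⁴|k|⁴` off the origin). -/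
theorem eNormSq_two_coef_le (v : Hsp) :
    Lattice.eNormSq 2 (mFourierCoeff (EuclideanSpace.complexify ∘ rep v)) ≤ eLaplacianNormSq (rep v) := by
  rw [Lattice.eNormSq, eLaplacianNormSq_rep_eq]
  refine ENNReal.tsum_le_tsum fun k => ?_
  by_cases hk : k = 0
  · subst hk
    rw [coef_zero]
    simp
  · refine mul_le_mul' (ENNReal.ofReal_le_ofReal ?_) le_rfl
    have h1 : 1 ≤ freqNormSq k := one_le_freqNormSq hk
    have hπ : 1 ≤ Real.pi := by linarith [Real.pi_gt_three]
    have hπ4 : 1 ≤ Real.pi ^ 4 := one_le_pow₀ hπ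
    calc sobolevWeight 2 k ^ 2 = (1 + freqNormSq k) ^ 2 := by rw [sobolevWeight_sq, Real.rpow_two]
      _ ≤ (2 * freqNormSq k) ^ 2 := pow_le_pow_left₀ (by linarith) (by linarith) 2
      _ = 4 * freqNormSq k ^ 2 := by ring
      _ ≤ 16 * Real.pi ^ 4 * freqNormSq k ^ 2 := by nlinarith [sq_nonneg (freqNormSq k)]

/-- The lattice `H_0` distance of two coefficient families is the `H`-distance of the states (Parseval). -/
theorem eNormSq_zero_coef_sub (a b : Hsp) :
    Lattice.eNormSq 0 (mFourierCoeff (EuclideanSpace.complexify ∘ rep a) -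
      mFourierCoeff (EuclideanSpace.complexify ∘ rep b)) = edist a b ^ 2 := by
  rw [edist_eq_enorm_sub, enorm_sq_eq_tsum_coef, Lattice.eNormSq]
  refine tsum_congr fun k => ?_
  rw [sobolevWeight_zero, one_pow, ENNReal.ofReal_one, one_mul, Pi.sub_apply, coef_sub]

/-- **Sequential compactness of the spectral `H²`-sublevel sets of `H`** (Rellich `H_2 ↪ H_0` on the lattice,
completeness of `H`, closedness of the sublevel set). -/
theorem isSeqCompact_sublevel (C : ℝ) :
    IsSeqCompact {v : Hsp | eLaplacianNormSq (rep v) ≤ ENNReal.ofReal C} := by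
  intro x hx
  obtain ⟨φ, hφ, hCau⟩ := Lattice.rellich (V := EuclideanSpace ℂ (Fin 3)) (s := 0) (t := 2) (by norm_num)
    (u := fun n => mFourierCoeff (EuclideanSpace.complexify ∘ rep (x n))) (R := ENNReal.ofReal C)
    ENNReal.ofReal_ne_top (fun n => (eNormSq_two_coef_le (x n)).trans (hx n))
  have hcs : CauchySeq (x ∘ φ) := by
    refine Metric.cauchySeq_iff.2 fun ε hε => ?_
    obtain ⟨N, hN⟩ := hCau (ENNReal.ofReal ((ε / 2) ^ 2)) (ENNReal.ofReal_pos.2 (by positivity))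
    refine ⟨N, fun m hm n hn => ?_⟩
    have h := hN m n hm hn
    rw [eNormSq_zero_coef_sub, ENNReal.ofReal_pow (by positivity : (0 : ℝ) ≤ ε / 2),
      ENNReal.pow_le_pow_left_iff two_ne_zero, edist_le_ofReal (by positivity)] at h
    exact h.trans_lt (half_lt_self hε)
  obtain ⟨a, ha⟩ := cauchySeq_tendsto_of_complete hcs
  exact ⟨a, (isClosed_sublevel C).mem_of_tendsto ha (Eventually.of_forall fun n => hx (φ n)), φ, hφ, ha⟩

/-! ## Continuity of the enstrophy on the sublevel sets (uniform low-mode approximation) -/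

/-- The low-mode truncation `∑_{|k| ≤ N} 4π²|k|² ‖v̂(k)‖²` of the enstrophy is finite. -/
theorem head_ne_top (N : ℕ) (v : Hsp) :
    ∑ k ∈ freqBall N, ENNReal.ofReal (4 * Real.pi ^ 2 * freqNormSq k) *
      ‖mFourierCoeff (EuclideanSpace.complexify ∘ rep v) k‖ₑ ^ 2 ≠ ⊤ :=
  ENNReal.sum_ne_top.2 fun _ _ => ENNReal.mul_ne_top ENNReal.ofReal_ne_top (ENNReal.pow_ne_top enorm_ne_top)

/-- The low-mode truncation of the enstrophy is continuous on `H` (finitely many continuous coefficients). -/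
theorem continuous_head (N : ℕ) :
    Continuous fun v : Hsp => ∑ k ∈ freqBall N, ENNReal.ofReal (4 * Real.pi ^ 2 * freqNormSq k) *
      ‖mFourierCoeff (EuclideanSpace.complexify ∘ rep v) k‖ₑ ^ 2 := by
  refine continuous_finsetSum _ fun k _ => ?_
  exact (ENNReal.continuous_const_mul ENNReal.ofReal_ne_top).comp
    ((ENNReal.continuous_pow 2).comp (continuous_coef k).enorm)

/-- The low-mode truncation of the enstrophy, as a real number, is continuous on `H`. -/
theorem continuous_toReal_head (N : ℕ) :
    Continuous fun v : Hsp => (∑ k ∈ freqBall N, ENNReal.ofReal (4 * Real.pi ^ 2 * freqNormSq k) *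
      ‖mFourierCoeff (EuclideanSpace.complexify ∘ rep v) k‖ₑ ^ 2).toReal :=
  ENNReal.continuousOn_toReal.comp_continuous (continuous_head N) fun v => head_ne_top N v

/-- Low modes plus tail: `‖∇v‖₂² = ∑_{|k| ≤ N} 4π²|k|²‖v̂(k)‖² + ∑_{|k| > N} 4π²|k|²‖v̂(k)‖²`. -/
theorem eGradNormSq_eq_head_add_tail (N : ℕ) (v : Hsp) :
    eGradNormSq (rep v) =
      (∑ k ∈ freqBall N, ENNReal.ofReal (4 * Real.pi ^ 2 * freqNormSq k) *
        ‖mFourierCoeff (EuclideanSpace.complexify ∘ rep v) k‖ₑ ^ 2) +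
      ∑' k : ↥(((freqBall N : Finset (Fin 3 → ℤ)) : Set (Fin 3 → ℤ))ᶜ),
        ENNReal.ofReal (4 * Real.pi ^ 2 * freqNormSq (k : Fin 3 → ℤ)) *
          ‖mFourierCoeff (EuclideanSpace.complexify ∘ rep v) k‖ₑ ^ 2 := by
  rw [eGradNormSq_rep_eq, ENNReal.sum_add_tsum_compl]

/-- **Tail estimate**: `N² · ∑_{|k| > N} 4π²|k|² ‖v̂(k)‖² ≤ ‖Δv‖₂²` (`N² · 4π²|k|² ≤ 16π⁴|k|⁴` for
`|k|² > N²`). -/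
theorem sq_mul_tail_le (N : ℕ) (v : Hsp) :
    ENNReal.ofReal ((N : ℝ) ^ 2) *
        ∑' k : ↥(((freqBall N : Finset (Fin 3 → ℤ)) : Set (Fin 3 → ℤ))ᶜ),
          ENNReal.ofReal (4 * Real.pi ^ 2 * freqNormSq (k : Fin 3 → ℤ)) *
            ‖mFourierCoeff (EuclideanSpace.complexify ∘ rep v) k‖ₑ ^ 2 ≤
      eLaplacianNormSq (rep v) := by
  rw [eLaplacianNormSq_rep_eq, ← ENNReal.sum_add_tsum_compl (freqBall N), ← ENNReal.tsum_mul_left]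
  refine le_add_left (ENNReal.tsum_le_tsum fun k => ?_)
  rw [← mul_assoc]
  refine mul_le_mul' ?_ le_rfl
  have hk : (k : Fin 3 → ℤ) ∉ freqBall N := by
    have h := k.2
    rwa [Set.mem_compl_iff, Finset.mem_coe] at h
  have hlt : (N : ℝ) ^ 2 < freqNormSq (k : Fin 3 → ℤ) := not_mem_freqBall.1 hk
  rw [← ENNReal.ofReal_mul (sq_nonneg _)]
  refine ENNReal.ofReal_le_ofReal ?_
  have hπ : 1 ≤ Real.pi := by linarith [Real.pi_gt_three]
  have hπ2 : 1 ≤ Real.pi ^ 2 := one_le_pow₀ hπ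
  have hf : 0 ≤ freqNormSq (k : Fin 3 → ℤ) := freqNormSq_nonneg _
  have h1 : 0 ≤ 4 * Real.pi ^ 2 * freqNormSq (k : Fin 3 → ℤ) := by positivity
  have h2 : (N : ℝ) ^ 2 ≤ 4 * Real.pi ^ 2 * freqNormSq (k : Fin 3 → ℤ) := by nlinarith
  nlinarith [mul_le_mul_of_nonneg_left h2 h1]

/-- **Uniform convergence of the truncations on sublevel sets**: on `{‖Δv‖₂² ≤ C}` the real truncated
enstrophies converge to `enstrophyObs` uniformly (tail `≤ C/N²`). -/
theorem tendstoUniformlyOn_head (C : ℝ) :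
    TendstoUniformlyOn
      (fun (N : ℕ) (v : Hsp) => (∑ k ∈ freqBall N, ENNReal.ofReal (4 * Real.pi ^ 2 * freqNormSq k) *
        ‖mFourierCoeff (EuclideanSpace.complexify ∘ rep v) k‖ₑ ^ 2).toReal)
      enstrophyObs atTop {v : Hsp | eLaplacianNormSq (rep v) ≤ ENNReal.ofReal C} := by
  refine Metric.tendstoUniformlyOn_iff.2 fun ε hε => ?_
  obtain ⟨N₀, hN₀⟩ := exists_nat_gt (max C 0 / ε)
  refine eventually_atTop.2 ⟨N₀, fun N hN v hv => ?_⟩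
  have hv' : eLaplacianNormSq (rep v) ≤ ENNReal.ofReal C := hv
  -- the split into low modes `Hd` and tail `Tl`
  have hsplit := eGradNormSq_eq_head_add_tail N v
  have htail := sq_mul_tail_le N v
  set Hd := ∑ k ∈ freqBall N, ENNReal.ofReal (4 * Real.pi ^ 2 * freqNormSq k) *
    ‖mFourierCoeff (EuclideanSpace.complexify ∘ rep v) k‖ₑ ^ 2 with hHd
  set Tl := ∑' k : ↥(((freqBall N : Finset (Fin 3 → ℤ)) : Set (Fin 3 → ℤ))ᶜ),
    ENNReal.ofReal (4 * Real.pi ^ 2 * freqNormSq (k : Fin 3 → ℤ)) *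
      ‖mFourierCoeff (EuclideanSpace.complexify ∘ rep v) k‖ₑ ^ 2 with hTl
  have hGfin : eGradNormSq (rep v) ≠ ⊤ :=
    ne_top_of_le_ne_top ENNReal.ofReal_ne_top ((eGradNormSq_le_eLaplacianNormSq v).trans hv')
  rw [hsplit] at hGfin
  have hTfin : Tl ≠ ⊤ := (ENNReal.add_ne_top.1 hGfin).2
  -- `N ≥ 1` and `max C 0 < ε N²`
  have hN₀N : (N₀ : ℝ) ≤ N := Nat.cast_le.2 hN
  have hdiv : 0 ≤ max C 0 / ε := div_nonneg (le_max_right _ _) hε.le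
  have hN0 : (0 : ℝ) < N := by linarith
  have h1N : (1 : ℝ) ≤ N := Nat.one_le_cast.2 (Nat.cast_pos.1 hN0)
  have hCN : max C 0 < (N : ℝ) * ε := (div_lt_iff₀ hε).1 (hN₀.trans_le hN₀N)
  have hNN : (N : ℝ) * ε ≤ (N : ℝ) ^ 2 * ε := by nlinarith [mul_nonneg hN0.le hε.le]
  -- the tail is `< ε`
  have hTlt : Tl < ENNReal.ofReal ε := by
    have h1 : ENNReal.ofReal ((N : ℝ) ^ 2) * Tl ≤ ENNReal.ofReal (max C 0) :=
      htail.trans (hv'.trans (ENNReal.ofReal_le_ofReal (le_max_left _ _)))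
    have h2 : ENNReal.ofReal (max C 0) < ENNReal.ofReal ((N : ℝ) ^ 2) * ENNReal.ofReal ε := by
      rw [← ENNReal.ofReal_mul (sq_nonneg _)]
      exact (ENNReal.ofReal_lt_ofReal_iff (by positivity)).2 (by linarith)
    exact (ENNReal.mul_lt_mul_iff_right (ne_of_gt (ENNReal.ofReal_pos.2 (by positivity)))
      ENNReal.ofReal_ne_top).1 (h1.trans_lt h2)
  -- conclude
  have hobs : enstrophyObs v = Hd.toReal + Tl.toReal := by
    show (eGradNormSq (rep v)).toReal = _
    rw [hsplit, ENNReal.toReal_add (head_ne_top N v) hTfin]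
  rw [Real.dist_eq, hobs, add_sub_cancel_left, abs_of_nonneg ENNReal.toReal_nonneg]
  exact ENNReal.toReal_lt_of_lt_ofReal hTlt

/-- **`L²`-continuity of the enstrophy on spectral `H²`-sublevel sets** (uniform limit of the continuous
truncations). -/
theorem continuousOn_enstrophyObs (C : ℝ) :
    ContinuousOn enstrophyObs {v : Hsp | eLaplacianNormSq (rep v) ≤ ENNReal.ofReal C} :=
  (tendstoUniformlyOn_head C).continuousOn
    (Frequently.of_forall fun N => (continuous_toReal_head N).continuousOn)

end CompactSublevel

/-! ## The stub -/

open CompactSublevel in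
/-- Stub P4 **COMPACT SUBLEVEL SETS**: for every level `C`, the spectral `H²`-sublevel set
`{v ∈ H : ‖Δv‖₂² ≤ C}` of the energy space is compact in `H` (Rellich), the enstrophy observable is
`L²`-continuous on it (uniform low-mode approximation), and the enstrophy is finite there (`‖∇v‖₂² ≤ ‖Δv‖₂²`).
(For `C < 0` the set is `{0}` and everything is trivially consistent.) -/
theorem stub_compactSublevel :
    ∀ C : ℝ,
      IsCompact {v : Hsp | eLaplacianNormSq (rep v) ≤ ENNReal.ofReal C} ∧
      ContinuousOn enstrophyObs {v : Hsp | eLaplacianNormSq (rep v) ≤ ENNReal.ofReal C} ∧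
      ∀ v : Hsp, eLaplacianNormSq (rep v) ≤ ENNReal.ofReal C → eGradNormSq (rep v) ≠ ⊤ := fun C =>
  ⟨(isSeqCompact_sublevel C).isCompact, continuousOn_enstrophyObs C, fun v hv =>
    ne_top_of_le_ne_top ENNReal.ofReal_ne_top ((eGradNormSq_le_eLaplacianNormSq v).trans hv)⟩

end Summit.AnomalousDissipation.AnomalousDissipation.Theorems.ChainRealisation.SeparatrixFluxPinning

end
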